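import Mathlib
import Literature.Analysis.FluidPDE.NSWave0
import Literature.Analysis.FluidPDE.ClassicalSolution
import Literature.Claims.NS.ClayVariants
import HarnessLib

/-!
# Claim skeleton (D-0090 NS-CLAIMS, C02): Jormakka, EJDE 2010 No. 93 — "Statement D" via non-periodic pressure

Typed skeleton of J. Jormakka, *Solutions to three-dimensional Navier–Stokes equations for incompressible
fluids*, Electron. J. Differential Equations 2010, No. 93, pp. 1–14 (bib `Jormakka2010`; page numbers are EJDE
print pages; arXiv:0809.3553, whose unrefereed v7 (2012) adds "Theorem 2.4 is indeed a valid proof of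
Statement D" and a section "Answering critizism" naming objections raised against it — the dispute of record
for the `[claim: …, status: disputed]` tags below, with Tao 2013, Prop. 7). NOTHING here asserts a step of the paper: its statements are `def … : Prop` (parametrised by the
viscosity `ν`, fixed on p. 1 as "a positive coefficient"); the `theorem`s are kernel-checked RELATIONS between
them, elementary properties of the explicit formulas, and the comparison with the tree's Clay (D) leaves
(printed (D) = `Summit.NavierStokesRegularity.NavierStokesRegularity.NavierStokesBreakdownPeriodic`, CMI-errata
(D) = `…NavierStokesBreakdownPeriodicPressurePeriodic`; imported conjecture leaves, not restated; `clayD_iff`,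
`clayDErrata_iff` pin this file's helper predicates to them). Verdict vocabulary is the refuter's/referee's.

Path to the headline (v7 l.1017: "only requires Lemma 2.1, Theorem 2.3 and Theorem 2.4"):
* p. 2: `initialField` = `u⁰`, family (2.1) = `velocity ν g`, `pressure ν g`
  (`u = e^{−βt}u⁰(x + g(t)(1,1,1)) − g′(t)(1,1,1)`, `p = e^{−2βt}P⁰(x + g(t)(1,1,1)) + g″(t)(x₁+x₂+x₃)`,
  `β = (2π)²ν`): the extended-Galilean orbit (tree: `IsClassicalNSSolutionOn.galileanBoost`, frame path
  `g(t)(1,1,1)`) of one decaying strong-Beltrami solution (`u⁰(x) = 2π·S(abc₁₁₁(2π·Sx))`, `S` = swap of the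
  last two coordinates, `curl u⁰ = −2πu⁰`; tree: `BeltramiFlows`). `Lemma21 ν` = Lemma 2.1.
* p. 3: `Theorem22 ν` = Theorem 2.2 (C1 non-uniqueness, C2 unbounded / bounded periodic solutions).
* p. 4: `blowupGauge` = `g(t) = ½ct²/(a−t)`; `Theorem23Witness ν c a` = the assertions of the proof of
  Theorem 2.3 about `(U, P)`; `Theorem23 ν` = Theorem 2.3 as printed (∃ ONE non-continuable solution).
* pp. 4–5: `feedbackForce ν c a u` = "fᵢ := ∂ₜuᵢ − ∂ₜUᵢ" (a FUNCTIONAL of the candidate `u`); `Step24Solves`,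
  `Step24ZeroForceUnique`, `Step24Unique` = the three assertions of the proof of Theorem 2.4;
  `Theorem24ClosedLoop ν c a` = what that proof argues; `Theorem24AsPrinted ν` (weak) /
  `Theorem24AsPrintedStrong ν` = the two readings of the printed Theorem 2.4 ("a smooth f(x,t) on ℝ³ × [0,∞)
  defined as a feedback control function using the values of u(x,t)"); `ClayDInstance ν` /
  `ClayDErrataInstance ν` = Clay (D)'s conclusion at the exhibited data (`u⁰`, realized force `f ≡ 0`).

Kernel relations proved: `theorem24ClosedLoop_of_steps` (Thm 2.3 witness ∧ `Step24Unique` → closed-loop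
non-existence: the proof of Thm 2.4 composes THIS far), `theorem23_of_witness`, `step24Solves_of_witness`,
`theorem24AsPrinted_of_closedLoop`, `theorem24AsPrinted_trivial` (the weak reading has no content),
`theorem24AsPrintedStrong_of_clayD` (Clay (D) ⇒ strong reading; the converse is what p. 13 needs),
`not_clayDInstance_of_lemma21` / `not_clayDErrataInstance_of_lemma21` (IF Lemma 2.1 holds, (D)'s conclusion
FAILS at the exhibited data: the `g ≡ 0` member of (2.1) is global, smooth, `u`- and `p`-periodic, p. 3).
NOT derivable, not asserted: `Theorem24ClosedLoop`/`Theorem24AsPrinted` → `NavierStokesBreakdownPeriodic`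
(p. 13: "Unless Theorem 2.4 is accepted as a proof of Statement D in [1], the official problem statement …
must be corrected"): Clay (D) has `∃ f` — a function, "a given, externally applied force" (Fefferman p. 1) —
BEFORE `¬ ∃ (p, u)`; the paper's `f` is a functional of `(p, u)`. This non-implication is the typed delta.
Cell schema (claims/CARD-TEMPLATE.md §5, TYPING-HYGIENE.md §10; reference specs
`Literature.Claims.NS.ClayVariants`): `ClaimedTheorem` (:= the closed-loop Theorem 2.4 for all parameters
the proof admits, `ν > 0`, `c ≠ 0`, `a > 1`), `claim_of_steps` (from `Theorem23Witness` and `Step24Unique`),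
`ClayDelta` (axis Δ3 FORCE: "open-loop solutions of `(u⁰, f ≡ 0)` are closed-loop solutions" — the exact
bridging hypothesis), `clay_of_claimed_of_delta : ClayDelta → ClaimedTheorem → clayPeriodic.Breakdown`
(proved), `not_clayDelta_of_lemma21` (the bridge contradicts Lemma 2.1 + Theorem 2.4 themselves),
`isPeriodicDatum_initialField` (the datum IS of Clay class (8): smooth, divergence free, periodic — proved).
Not typed (off the path): Lemmas 2.5–2.9 (pp. 5–9), §3 (pp. 9–12). Mechanism in print: Tao, Anal. PDE 6
(2013), §2 (Galilean symmetry, non-periodic pressure), Prop. 7 and footnote ("technical loophole of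
non-periodic pressure") [Tao2013Localisation].

WHAT THIS IS NOT: not a claim about NS regularity or blow-up; not a claim about any author beyond the typed
locator.
-/

noncomputable section

open Set Function Real Filter
open scoped ContDiff Topology

namespace Literature.Claims.NS.Jormakka2010

open Literature.Analysis.FluidPDE

/-! ### Clay-side helper predicates (conjunctions of the tree's wave-0 predicates; no new notion) -/

/-- Data conditions of the periodic Clay problems for `u⁰`: smooth, divergence free (Fefferman (2) at `t = 0`),
`ℤ³`-periodic (8) — the conjunction used verbatim in the tree's (B)/(D) leaves; = (2.2)/(2.6) of Jormakka for
`u⁰`. [cite: FeffermanClay2006, statement (D) with (8) p.2] -/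
def IsPeriodicDatum (u₀ : EuclideanSpace ℝ (Fin 3) → EuclideanSpace ℝ (Fin 3)) : Prop :=
  ContDiff ℝ ∞ u₀ ∧ NSWave0.IsDivFree u₀ ∧ IsLatticePeriodic u₀

/-- Force conditions of Clay (D): `f` smooth on `ℝ³ × [0,∞)`, `ℤ³`-periodic in `x` for `t ≥ 0` (8), all
derivatives rapidly decaying in time (9) — verbatim the tree's (D) leaves; = (2.2)–(2.3)/(2.6)–(2.7) of
Jormakka. [cite: FeffermanClay2006, statement (D) with (8) (9) p.2] -/
def IsAdmissibleForce (f : ℝ → EuclideanSpace ℝ (Fin 3) → EuclideanSpace ℝ (Fin 3)) : Prop :=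
  IsSmoothOnHalfSpace f ∧ (∀ t, 0 ≤ t → IsLatticePeriodic (f t)) ∧ HasRapidTimeDecay f

/-- The solution class excluded by printed Clay (D): `(u, p)` smooth on `ℝ³ × [0,∞)` (11), solving (1), (2),
(3) with viscosity `ν`, force `f`, datum `u₀`, with `u(·, t)` `ℤ³`-periodic for `t ≥ 0` (10) (pressure
unconstrained) — verbatim the matrix of the tree's printed-(D) leaf; = Jormakka's (1.1)–(1.3), (2.8), (2.9).
[cite: FeffermanClay2006, statement (D) with (10) (11) p.2] -/
def IsGlobalPeriodicSolution (ν : ℝ) (f : ℝ → EuclideanSpace ℝ (Fin 3) → EuclideanSpace ℝ (Fin 3))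
    (u₀ : EuclideanSpace ℝ (Fin 3) → EuclideanSpace ℝ (Fin 3))
    (u : ℝ → EuclideanSpace ℝ (Fin 3) → EuclideanSpace ℝ (Fin 3)) (p : ℝ → EuclideanSpace ℝ (Fin 3) → ℝ) :
    Prop :=
  IsSmoothOnHalfSpace u ∧ IsSmoothOnHalfSpace p ∧ IsNavierStokesSolution ν f u₀ u p ∧
    ∀ t, 0 ≤ t → IsLatticePeriodic (u t)

/-- The tree's printed Clay (D) leaf, rewritten through the three helper predicates (pure regrouping of
conjunctions; this is the kernel check that the vocabulary of this file IS the audited leaf's).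
[cite: FeffermanClay2006, statement (D) p.2] -/
theorem clayD_iff : Summit.NavierStokesRegularity.NavierStokesRegularity.NavierStokesBreakdownPeriodic ↔
    ∀ ν : ℝ, 0 < ν → ∃ (u₀ : EuclideanSpace ℝ (Fin 3) → EuclideanSpace ℝ (Fin 3))
      (f : ℝ → EuclideanSpace ℝ (Fin 3) → EuclideanSpace ℝ (Fin 3)),
      IsPeriodicDatum u₀ ∧ IsAdmissibleForce f ∧ ¬ ∃ u p, IsGlobalPeriodicSolution ν f u₀ u p := by
  constructor
  · intro h ν hν
    obtain ⟨u₀, f, h1, h2, h3, h4, h5, h6, h7⟩ := h ν hν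
    exact ⟨u₀, f, ⟨h1, h2, h3⟩, ⟨h4, h5, h6⟩, h7⟩
  · intro h ν hν
    obtain ⟨u₀, f, ⟨h1, h2, h3⟩, ⟨h4, h5, h6⟩, h7⟩ := h ν hν
    exact ⟨u₀, f, h1, h2, h3, h4, h5, h6, h7⟩

/-- The tree's CMI-errata Clay (D) leaf (excluded solutions have `u` AND `p` periodic), through the helper
predicates. [cite: FeffermanClay2006, statement (D) p.2 and errata page] -/
theorem clayDErrata_iff :
    Summit.NavierStokesRegularity.NavierStokesRegularity.NavierStokesBreakdownPeriodicPressurePeriodic ↔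
    ∀ ν : ℝ, 0 < ν → ∃ (u₀ : EuclideanSpace ℝ (Fin 3) → EuclideanSpace ℝ (Fin 3))
      (f : ℝ → EuclideanSpace ℝ (Fin 3) → EuclideanSpace ℝ (Fin 3)),
      IsPeriodicDatum u₀ ∧ IsAdmissibleForce f ∧
        ¬ ∃ u p, IsGlobalPeriodicSolution ν f u₀ u p ∧ ∀ t, 0 ≤ t → IsLatticePeriodic (p t) := by
  constructor
  · intro h ν hν
    obtain ⟨u₀, f, h1, h2, h3, h4, h5, h6, h7⟩ := h ν hν
    refine ⟨u₀, f, ⟨h1, h2, h3⟩, ⟨h4, h5, h6⟩, ?_⟩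
    rintro ⟨u, p, ⟨hu, hp, hns, hper⟩, hpp⟩
    exact h7 ⟨u, p, hu, hp, hns, fun t ht => ⟨hper t ht, hpp t ht⟩⟩
  · intro h ν hν
    obtain ⟨u₀, f, ⟨h1, h2, h3⟩, ⟨h4, h5, h6⟩, h7⟩ := h ν hν
    refine ⟨u₀, f, h1, h2, h3, h4, h5, h6, ?_⟩
    rintro ⟨u, p, hu, hp, hns, hper⟩
    exact h7 ⟨u, p, ⟨hu, hp, hns, fun t ht => (hper t ht).1⟩, fun t ht => (hper t ht).2⟩

/-! ### The explicit objects of Lemma 2.1 (p. 2) and of the proofs of Theorems 2.3–2.4 (p. 4) -/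

/-- The initial field `u⁰` of Lemma 2.1 (p. 2): `u⁰₁ = 2π sin(2πx₂) + 2π cos(2πx₃)`,
`u⁰₂ = 2π sin(2πx₃) + 2π cos(2πx₁)`, `u⁰₃ = 2π sin(2πx₁) + 2π cos(2πx₂)` (coordinates `x 0, x 1, x 2` for
`x₁, x₂, x₃`). [cite: Jormakka2010, Lemma 2.1 p.2] -/
def initialField (x : EuclideanSpace ℝ (Fin 3)) : EuclideanSpace ℝ (Fin 3) :=
  !₂[2 * π * (sin (2 * π * x 1) + cos (2 * π * x 2)),
    2 * π * (sin (2 * π * x 2) + cos (2 * π * x 0)),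
    2 * π * (sin (2 * π * x 0) + cos (2 * π * x 1))]

/-- The drift direction `(1, 1, 1)` of the family (2.1) (the shift `xⱼ ↦ xⱼ + g(t)` in every coordinate and
the additive term `−g′(t)` in every component). [cite: Jormakka2010, Lemma 2.1 eq. (2.1) p.2] -/
def ones : EuclideanSpace ℝ (Fin 3) := !₂[1, 1, 1]

/-- The `x`-dependent factor of the pressure in (2.1) at `g = 0`, `t = 0`:
`P⁰(x) = −(2π)² [sin(2πx₁)cos(2πx₂) + sin(2πx₂)cos(2πx₃) + sin(2πx₃)cos(2πx₁)]` (`= −½|u⁰|² + const`).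
[cite: Jormakka2010, Lemma 2.1 eq. (2.1) p.2] -/
def basePressure (x : EuclideanSpace ℝ (Fin 3)) : ℝ :=
  -((2 * π) ^ 2 * (sin (2 * π * x 0) * cos (2 * π * x 1) + sin (2 * π * x 1) * cos (2 * π * x 2) +
    sin (2 * π * x 2) * cos (2 * π * x 0)))

/-- The velocity of the family (2.1) for a gauge function `g` (p. 2), `β = (2π)²ν`:
`uᵢ(x, t) = e^{−βt} 2π (sin 2π(x_k + g(t)) + cos 2π(x_m + g(t))) − g′(t)`, `(i,k,m)` cyclic, i.e.
`u(t, x) = e^{−βt} u⁰(x + g(t)(1,1,1)) − g′(t)(1,1,1)`. Time first, as in the tree. `g′ = deriv g` (junk `0`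
where `g` is not differentiable). [cite: Jormakka2010, Lemma 2.1 eq. (2.1) p.2] -/
def velocity (ν : ℝ) (g : ℝ → ℝ) (t : ℝ) (x : EuclideanSpace ℝ (Fin 3)) : EuclideanSpace ℝ (Fin 3) :=
  exp (-((2 * π) ^ 2 * ν * t)) • initialField (x + g t • ones) - deriv g t • ones

/-- The pressure of the family (2.1) (p. 2): `p(t, x) = e^{−2βt} P⁰(x + g(t)(1,1,1)) + g″(t)(x₁ + x₂ + x₃)`
— NOT periodic in `x` unless `g″(t) = 0`. [cite: Jormakka2010, Lemma 2.1 eq. (2.1) p.2] -/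
def pressure (ν : ℝ) (g : ℝ → ℝ) (t : ℝ) (x : EuclideanSpace ℝ (Fin 3)) : ℝ :=
  exp (-(2 * ((2 * π) ^ 2 * ν * t))) * basePressure (x + g t • ones) +
    deriv (deriv g) t * (x 0 + x 1 + x 2)

/-- The gauge of the proof of Theorem 2.3 (p. 4): `g(t) = ½ c t² · 1/(a − t)`, `c ≠ 0`, `a > 0`
(`g(0) = g′(0) = 0`; `g′(t) → ∞` as `t → a⁻`). Junk value at `t = a` (division by zero). [cite: Jormakka2010, Theorem 2.3 (proof) p.4] -/
def blowupGauge (c a : ℝ) (t : ℝ) : ℝ := c * t ^ 2 / (2 * (a - t))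

/-- `U` of the proof of Theorem 2.4 (p. 4) = the Theorem 2.3 velocity: (2.1) with `g = blowupGauge c a`.
[cite: Jormakka2010, Theorem 2.4 (proof) p.4] -/
def blowupVelocity (ν c a : ℝ) : ℝ → EuclideanSpace ℝ (Fin 3) → EuclideanSpace ℝ (Fin 3) :=
  velocity ν (blowupGauge c a)

/-- The pressure accompanying `U` (Theorem 2.3, proof p. 4): (2.1) with `g = blowupGauge c a`.
[cite: Jormakka2010, Theorem 2.3 (proof) p.4] -/
def blowupPressure (ν c a : ℝ) : ℝ → EuclideanSpace ℝ (Fin 3) → ℝ :=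
  pressure ν (blowupGauge c a)

/-- The "feedback control force" of the proof of Theorem 2.4 (p. 4): "we allow zero control delay and select
`f(x,t)` as `fᵢ(x,t) = ∂ₜuᵢ(x,t) − ∂ₜUᵢ(x,t)` … This force is defined in the open interval `t ∈ [0,a)` and
can be smoothly continued as zero to `[a,∞)`." Typed as a map from candidate velocities `u` to force fields
(time derivatives one-sided within `[0,∞)`, the convention of `IsNavierStokesSolution`). With this `f`,
(1.1) on `[0,a)` reads `∂ₜUᵢ + Σⱼ uⱼ∂ⱼuᵢ = νΔuᵢ − ∂ᵢp` (display, p. 4). [claim: Jormakka2010, status: disputed] -/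
def feedbackForce (ν c a : ℝ) (u : ℝ → EuclideanSpace ℝ (Fin 3) → EuclideanSpace ℝ (Fin 3)) :
    ℝ → EuclideanSpace ℝ (Fin 3) → EuclideanSpace ℝ (Fin 3) :=
  fun t x => if t < a then timeDerivWithin (Ici 0) u t x - timeDerivWithin (Ici 0) (blowupVelocity ν c a) t x
    else 0

/-! ### Elementary kernel facts about the explicit formulas (used by the relations below) -/

/-- `u⁰` is `ℤ³`-periodic ("The initial vector field is smooth, periodic …", proof of Lemma 2.1, p. 2).
[cite: Jormakka2010, Lemma 2.1 (proof) p.2] -/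
theorem isLatticePeriodic_initialField : IsLatticePeriodic initialField := by
  intro j x
  ext i
  fin_cases j <;> fin_cases i <;>
    simp [initialField, mul_add, sin_add_two_pi, cos_add_two_pi]

/-- `P⁰` is `ℤ³`-periodic. [cite: Jormakka2010, Lemma 2.1 eq. (2.1) p.2] -/
theorem isLatticePeriodic_basePressure : IsLatticePeriodic basePressure := by
  intro j x
  fin_cases j <;>
    simp [basePressure, mul_add, sin_add_two_pi, cos_add_two_pi]

/-- Every velocity of the family (2.1) is `ℤ³`-periodic in `x` at every time ("The solution (2.1) in
Lemma 2.1 is periodic in space variables with the period as one", p. 4). [cite: Jormakka2010, Theorem 2.3 (proof) p.4] -/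
theorem isLatticePeriodic_velocity (ν : ℝ) (g : ℝ → ℝ) (t : ℝ) : IsLatticePeriodic (velocity ν g t) := by
  intro j x
  simp only [velocity]
  rw [add_right_comm x, isLatticePeriodic_initialField j]

/-- The pressure of (2.1) is `ℤ³`-periodic at every time at which `g″ = 0` (in particular for `g ≡ 0`:
"If `c = 0` then the solution is bounded and it is periodic as a function of `x`", p. 3).
[cite: Jormakka2010, Theorem 2.2 (proof) p.3] -/
theorem isLatticePeriodic_pressure (ν : ℝ) {g : ℝ → ℝ} {t : ℝ} (hg : deriv (deriv g) t = 0) :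
    IsLatticePeriodic (pressure ν g t) := by
  intro j x
  simp only [pressure, hg, zero_mul, add_zero]
  rw [add_right_comm x, isLatticePeriodic_basePressure j]

/-- "Becomes infinite when `t` approaches `a` ⇒ cannot be continued": if `t ↦ ‖U(t, x)‖ → ∞` as `t → a⁻`
(`0 < a`) for some `x`, then no field smooth on `ℝ³ × [0,∞)` agrees with `U` on `[0, a)` (continuity at
`(a, x)` within the half-space would bound it). Elementary; this is the implication used on p. 4 (Thm 2.3:
"`g′(t)` becomes infinite at `t = a` … Thus, the solution `u(x,t)` cannot be continued") and p. 5 (Thm 2.4).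
[cite: Jormakka2010, Theorem 2.3 (proof) p.4] -/
theorem hasNoSmoothContinuation_of_tendsto {a : ℝ} (ha : 0 < a)
    {U : ℝ → EuclideanSpace ℝ (Fin 3) → EuclideanSpace ℝ (Fin 3)} {x : EuclideanSpace ℝ (Fin 3)}
    (hU : Tendsto (fun t => ‖U t x‖) (𝓝[<] a) atTop)
    {u : ℝ → EuclideanSpace ℝ (Fin 3) → EuclideanSpace ℝ (Fin 3)} (hu : IsSmoothOnHalfSpace u)
    (hagree : ∀ t ∈ Ico 0 a, u t = U t) : False := by
  -- continuity of `t ↦ ‖u t x‖` at `a` within `[0, ∞)`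
  have hcont : ContinuousWithinAt (fun t => ‖u t x‖) (Ici 0) a := by
    have h1 : ContinuousOn (uncurry u) (Ici (0 : ℝ) ×ˢ univ) := hu.continuousOn
    have h2 : ContinuousWithinAt (uncurry u) (Ici (0 : ℝ) ×ˢ univ) ((fun t : ℝ => (t, x)) a) :=
      h1 (a, x) ⟨ha.le, mem_univ _⟩
    have h3 : ContinuousWithinAt (fun t : ℝ => (t, x)) (Ici 0) a :=
      (continuous_id.prodMk continuous_const).continuousWithinAt
    have h4 : MapsTo (fun t : ℝ => (t, x)) (Ici 0) (Ici (0 : ℝ) ×ˢ univ) :=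
      fun t ht => ⟨ht, mem_univ _⟩
    exact (ContinuousWithinAt.comp (f := fun t : ℝ => (t, x)) (x := a) h2 h3 h4).norm
  -- restrict both limits to `𝓝[Ioo 0 a] a`
  haveI : (𝓝[Ioo 0 a] a).NeBot := right_nhdsWithin_Ioo_neBot ha
  have hsub1 : 𝓝[Ioo 0 a] a ≤ 𝓝[Ici 0] a := nhdsWithin_mono a fun t ht => ht.1.le
  have hsub2 : 𝓝[Ioo 0 a] a ≤ 𝓝[<] a := nhdsWithin_mono a fun t ht => ht.2
  have hlim : Tendsto (fun t => ‖u t x‖) (𝓝[Ioo 0 a] a) (𝓝 ‖u a x‖) := hcont.tendsto.mono_left hsub1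
  have hinf : Tendsto (fun t => ‖u t x‖) (𝓝[Ioo 0 a] a) atTop := by
    refine (hU.mono_left hsub2).congr' ?_
    filter_upwards [self_mem_nhdsWithin] with t ht
    rw [hagree t ⟨ht.1.le, ht.2⟩]
  exact not_tendsto_nhds_of_tendsto_atTop hinf _ hlim

/-! ### The paper's statements, as printed (no assertion) -/

/-- **Lemma 2.1** (p. 2; proof pp. 2–3, direct substitution): "The initial vector field is smooth, periodic,
bounded and divergence-free" and, for every smooth `g : ℝ → ℝ` with `g(0) = g′(0) = 0`, the pair (2.1) is
`C^∞(ℝ³ × [0,∞))` and satisfies (1.1)–(1.3) with `f ≡ 0` and datum `u⁰`. (True; salvage: `galileanBoost` of a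
decaying strong Beltrami field — not proved here.) [cite: Jormakka2010, Lemma 2.1 p.2] -/
def Lemma21 (ν : ℝ) : Prop :=
  IsPeriodicDatum initialField ∧
    ∀ g : ℝ → ℝ, ContDiff ℝ ∞ g → g 0 = 0 → deriv g 0 = 0 →
      IsSmoothOnHalfSpace (velocity ν g) ∧ IsSmoothOnHalfSpace (pressure ν g) ∧
        IsNavierStokesSolution ν 0 initialField (velocity ν g) (pressure ν g)

/-- **Theorem 2.2** (p. 3): there is a periodic, `C^∞`, divergence-free `u⁰` such that C1: "there are
infinitely many `C^∞(ℝ³ × [0,∞))` functions `u` … and `p` satisfying (1.1), (1.2) and (1.3)" (with `f ≡ 0`,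
as in the proof), and C2: "there exist unbounded `u(x,t)` and `p(x,t)` satisfying (1.1), (1.2) and … (1.3).
There also exist bounded solutions that are periodic as functions of `x`." (Proof: `g = ½ct²`; `c = 0` gives
the bounded periodic one.) [cite: Jormakka2010, Theorem 2.2 p.3] -/
def Theorem22 (ν : ℝ) : Prop :=
  ∃ u₀ : EuclideanSpace ℝ (Fin 3) → EuclideanSpace ℝ (Fin 3), IsPeriodicDatum u₀ ∧
    {q : (ℝ → EuclideanSpace ℝ (Fin 3) → EuclideanSpace ℝ (Fin 3)) × (ℝ → EuclideanSpace ℝ (Fin 3) → ℝ) |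
        IsSmoothOnHalfSpace q.1 ∧ IsSmoothOnHalfSpace q.2 ∧ IsNavierStokesSolution ν 0 u₀ q.1 q.2}.Infinite ∧
    (∃ u p, IsSmoothOnHalfSpace u ∧ IsSmoothOnHalfSpace p ∧ IsNavierStokesSolution ν 0 u₀ u p ∧
      (¬ ∃ C : ℝ, ∀ t, 0 ≤ t → ∀ x, ‖u t x‖ ≤ C) ∧ ¬ ∃ C : ℝ, ∀ t, 0 ≤ t → ∀ x, |p t x| ≤ C) ∧
    (∃ u p, IsSmoothOnHalfSpace u ∧ IsSmoothOnHalfSpace p ∧ IsNavierStokesSolution ν 0 u₀ u p ∧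
      (∃ C : ℝ, ∀ t, 0 ≤ t → ∀ x, ‖u t x‖ ≤ C ∧ |p t x| ≤ C) ∧
      ∀ t, 0 ≤ t → IsLatticePeriodic (u t) ∧ IsLatticePeriodic (p t))

/-- **Proof of Theorem 2.3** (p. 4), the specific witness: for the gauge `g = ½ct²/(a − t)`, `(U, P)` is a
classical solution of the unforced system on `ℝ³ × [0, a)` ("The solution `u(x,t)` in (2.1) is smooth if
`t < a`, thus (2.5) holds"), with datum `u⁰`, `u`-periodic ("Thus (2.4) holds"), and "`g′(t)` becomes infinite
at `t = a` … the `g′(t)` additive term approaches infinity" / "`u₁ = U₁` becomes infinite when `t` approaches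
`a`" (p. 5) — typed as `‖U(t, x)‖ → ∞` for `t → a⁻`, every `x`. [cite: Jormakka2010, Theorem 2.3 (proof) p.4] -/
def Theorem23Witness (ν c a : ℝ) : Prop :=
  IsClassicalNSSolutionOn (Ico 0 a) ν 0 (blowupVelocity ν c a) (blowupPressure ν c a) ∧
    blowupVelocity ν c a 0 = initialField ∧
    (∀ t ∈ Ico 0 a, IsLatticePeriodic (blowupVelocity ν c a t)) ∧
    ∀ x, Tendsto (fun t => ‖blowupVelocity ν c a t x‖) (𝓝[<] a) atTop

/-- **Theorem 2.3** as printed (pp. 3–4): there exist a smooth, divergence-free `u⁰` and a smooth `f` on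
`ℝ³ × [0,∞)` satisfying (2.2) [= Clay (8)] and (2.3) [= (9)] "such that there exists `a > 0` and a solution
`(p, u)` of (1.1), (1.2), (1.3) satisfying" (2.4) [`u` periodic on `ℝ³ × [0,a)`] and (2.5)
[`p, u ∈ C^∞(ℝ³ × [0,a))`] "that cannot be smoothly continued to `ℝ³ × [0,∞)`" — an ∃-over-solutions
statement; continuation typed as a smooth solution of the same system on `[0,∞)` extending `(u, p)`.
[cite: Jormakka2010, Theorem 2.3 pp.3–4] -/
def Theorem23 (ν : ℝ) : Prop :=
  ∃ u₀ : EuclideanSpace ℝ (Fin 3) → EuclideanSpace ℝ (Fin 3), IsPeriodicDatum u₀ ∧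
    ∃ f : ℝ → EuclideanSpace ℝ (Fin 3) → EuclideanSpace ℝ (Fin 3), IsAdmissibleForce f ∧
      ∃ a : ℝ, 0 < a ∧ ∃ (u : ℝ → EuclideanSpace ℝ (Fin 3) → EuclideanSpace ℝ (Fin 3))
        (p : ℝ → EuclideanSpace ℝ (Fin 3) → ℝ),
        IsClassicalNSSolutionOn (Ico 0 a) ν f u p ∧ u 0 = u₀ ∧ (∀ t ∈ Ico 0 a, IsLatticePeriodic (u t)) ∧
          ¬ ∃ (u' : ℝ → EuclideanSpace ℝ (Fin 3) → EuclideanSpace ℝ (Fin 3))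
              (p' : ℝ → EuclideanSpace ℝ (Fin 3) → ℝ),
              IsSmoothOnHalfSpace u' ∧ IsSmoothOnHalfSpace p' ∧ IsNavierStokesSolution ν f u₀ u' p' ∧
                ∀ t ∈ Ico 0 a, u' t = u t ∧ p' t = p t

/-- Proof of Theorem 2.4, first assertion (p. 4): "There is a solution `u(x,t) = U(x,t)` to this equation"
— `(U, P)` solves the closed-loop system on `[0, a)` (where the feedback force vanishes identically).
[claim: Jormakka2010, status: disputed] -/
def Step24Solves (ν c a : ℝ) : Prop :=
  IsClassicalNSSolutionOn (Ico 0 a) ν (feedbackForce ν c a (blowupVelocity ν c a))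
    (blowupVelocity ν c a) (blowupPressure ν c a)

/-- Proof of Theorem 2.4, p. 5: "if the force `f(x,t)` is zero in Theorem 2.4, then necessarily the solution
`u(x,t)` equals `U(x,t)` because otherwise the force is not zero" — read literally: a global smooth
`u`-periodic closed-loop solution along which the feedback force vanishes on `[0,a)` coincides with `U` there
(true and elementary: `∂ₜ(u − U) = 0`, `u(0) = U(0)`; NOT what the conclusion uses). [claim: Jormakka2010, status: disputed] -/
def Step24ZeroForceUnique (ν c a : ℝ) : Prop :=
  ∀ u p, IsGlobalPeriodicSolution ν (feedbackForce ν c a u) initialField u p →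
    (∀ t ∈ Ico 0 a, feedbackForce ν c a u t = 0) → ∀ t ∈ Ico 0 a, u t = blowupVelocity ν c a t

/-- Proof of Theorem 2.4, p. 5, the load-bearing assertion: "the external control force can set the higher
order time derivatives of `u(x,t)` to those of `U(x,t)`, therefore … the solution can be set to `U(x,t)`" —
every global smooth `u`-periodic solution of the closed-loop system with datum `u⁰` coincides with `U` on
`[0, a)` (closed-loop uniqueness; asserted, no proof printed beyond the quoted sentence; v7 footnote #2:
"the feedback control force acts by selection, not by steering … Thus, the solution is unique").
[claim: Jormakka2010, status: disputed] -/
def Step24Unique (ν c a : ℝ) : Prop :=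
  ∀ u p, IsGlobalPeriodicSolution ν (feedbackForce ν c a u) initialField u p →
    ∀ t ∈ Ico 0 a, u t = blowupVelocity ν c a t

/-- Proof of Theorem 2.4, p. 5 l. 8–18, **the faithful LOCAL reading** (referee ns-claims-ref-1, RETYPE.md §2
R#3): "if a solution `u(x,t)` starts as `U(x,t)` in some small interval `t < ε` … then it will continue as
`U(x,t)` for all times `t < a` … the external control force can set the higher order time derivatives of
`u(x,t)` to those of `U(x,t)`, therefore … the solution can be set to `U(x,t)`" — every classical solution
`(u, p)` of the CLOSED-LOOP system on `ℝ³ × [0, a)` with datum `u⁰` and `u(·,t)` periodic coincides with `U`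
on `[0, a)`. `Step24Unique` is the global reading (solutions on `[0,∞)`), which this one implies
(`step24Unique_of_local`). [claim: Jormakka2010, status: disputed] -/
def Step24UniqueLocal (ν c a : ℝ) : Prop :=
  ∀ u p, IsClassicalNSSolutionOn (Ico 0 a) ν (feedbackForce ν c a u) u p → u 0 = initialField →
    (∀ t ∈ Ico 0 a, IsLatticePeriodic (u t)) → ∀ t ∈ Ico 0 a, u t = blowupVelocity ν c a t

/-- **Theorem 2.4, what its proof argues** (pp. 4–5): with `u⁰` of Lemma 2.1 and the feedback law
`f = ∂ₜu − ∂ₜU` (`U` from Theorem 2.3, `c ≠ 0`, `a > 1`), "there exist no solutions `(p, u)` of (1.1), (1.2),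
(1.3) on `ℝ³ × [0,∞)` satisfying (2.8) [`u` periodic] and (2.9) [`p, u ∈ C^∞(ℝ³ × [0,∞))`]" — non-existence
for the CLOSED-LOOP system (the force slot holds a functional of the candidate `u`). [claim: Jormakka2010, status: disputed] -/
def Theorem24ClosedLoop (ν c a : ℝ) : Prop :=
  ¬ ∃ u p, IsGlobalPeriodicSolution ν (feedbackForce ν c a u) initialField u p

/-- **Theorem 2.4 as printed, weak (charitable) reading** (p. 4): "There exists a smooth, divergence-free
vector field `u⁰(x)` on `ℝ³` and a smooth `f(x,t)` on `ℝ³ × [0,∞)` defined as a feedback control function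
using the values of `u(x,t)` … satisfying (2.6) [= (8)], (2.7) [= (9)] … such that there exist no solutions
`(p,u)` of (1.1), (1.2), (1.3) on `ℝ³ × [0,∞)` satisfying (2.8), (2.9)." Here `f` is a map `F` from
candidate velocities to force fields and (2.6)–(2.7) are read of the REALIZED force `F u` along each excluded
candidate (the paper checks them only along `u = U`, where `F U ≡ 0`, p. 5: "As in Theorem 2.3 the conditions
(2.6)-(2.8) hold"). See `theorem24AsPrinted_trivial`: this reading has no content. [claim: Jormakka2010, status: disputed] -/
def Theorem24AsPrinted (ν : ℝ) : Prop :=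
  ∃ u₀ : EuclideanSpace ℝ (Fin 3) → EuclideanSpace ℝ (Fin 3), IsPeriodicDatum u₀ ∧
    ∃ F : (ℝ → EuclideanSpace ℝ (Fin 3) → EuclideanSpace ℝ (Fin 3)) →
        ℝ → EuclideanSpace ℝ (Fin 3) → EuclideanSpace ℝ (Fin 3),
      ¬ ∃ u p, IsAdmissibleForce (F u) ∧ IsGlobalPeriodicSolution ν (F u) u₀ u p

/-- **Theorem 2.4 as printed, strong reading**: the feedback law produces a Clay-admissible force
((2.6)–(2.7), smooth on `ℝ³ × [0,∞)`) for EVERY input `u`, and the closed-loop system has no global smooth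
`u`-periodic solution. Clay (D) implies it (`theorem24AsPrintedStrong_of_clayD`, constant `F`); the paper's
`feedbackForce` is not of this kind (for a time-independent input `u` it equals `−∂ₜU` on `[0,a)`, unbounded as
`t → a⁻`). [claim: Jormakka2010, status: disputed] -/
def Theorem24AsPrintedStrong (ν : ℝ) : Prop :=
  ∃ u₀ : EuclideanSpace ℝ (Fin 3) → EuclideanSpace ℝ (Fin 3), IsPeriodicDatum u₀ ∧
    ∃ F : (ℝ → EuclideanSpace ℝ (Fin 3) → EuclideanSpace ℝ (Fin 3)) →
        ℝ → EuclideanSpace ℝ (Fin 3) → EuclideanSpace ℝ (Fin 3),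
      (∀ u, IsAdmissibleForce (F u)) ∧ ¬ ∃ u p, IsGlobalPeriodicSolution ν (F u) u₀ u p

/-- Clay (D)'s conclusion AT THE EXHIBITED DATA: `u⁰` of Lemma 2.1 and the realized force `f ≡ 0` ("if
`u(x,t) = U(x,t)` then the force `fᵢ(x,t)` takes zero value at every point", pp. 4–5) — "there exist no
solutions `(p,u)` of (1), (2), (3), (10), (11) on `ℝ³ × [0,∞)`" (printed reading, `p` free). This is what
§4 p. 13 offers Theorem 2.4 for. See `not_clayDInstance_of_lemma21`. [claim: Jormakka2010, status: disputed] -/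
def ClayDInstance (ν : ℝ) : Prop :=
  ¬ ∃ u p, IsGlobalPeriodicSolution ν 0 initialField u p

/-- The same at the exhibited data in the CMI-errata reading (excluded solutions have `u` and `p` periodic).
[claim: Jormakka2010, status: disputed] -/
def ClayDErrataInstance (ν : ℝ) : Prop :=
  ¬ ∃ u p, IsGlobalPeriodicSolution ν 0 initialField u p ∧ ∀ t, 0 ≤ t → IsLatticePeriodic (p t)

/-! ### Kernel relations -/

/-- The zero force is Clay-admissible ((8), (9), smooth), as used in the proof of Theorem 2.3 ("The force
`f(x,t)` is identically zero, thus (2.3) holds", p. 4). [cite: Jormakka2010, Theorem 2.3 (proof) p.4] -/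
theorem isAdmissibleForce_zero :
    IsAdmissibleForce (0 : ℝ → EuclideanSpace ℝ (Fin 3) → EuclideanSpace ℝ (Fin 3)) := by
  refine ⟨?_, fun t _ j x => rfl, ?_⟩
  · change ContDiffOn ℝ ∞ (fun q : ℝ × EuclideanSpace ℝ (Fin 3) => (0 : EuclideanSpace ℝ (Fin 3))) _
    exact contDiffOn_const
  · intro n K
    refine ⟨0, fun t _ x => ?_⟩
    have : uncurry (0 : ℝ → EuclideanSpace ℝ (Fin 3) → EuclideanSpace ℝ (Fin 3)) =
        fun _ => (0 : EuclideanSpace ℝ (Fin 3)) := rfl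
    rw [this, iteratedFDerivWithin_fun_zero]
    simp

/-- Along `U` the feedback force is identically zero ("if `u(x,t) = U(x,t)` then the force `fᵢ(x,t)` takes
zero value at every point", pp. 4–5). [cite: Jormakka2010, Theorem 2.4 (proof) pp.4–5] -/
theorem feedbackForce_self (ν c a : ℝ) : feedbackForce ν c a (blowupVelocity ν c a) = 0 := by
  funext t x
  simp [feedbackForce]

/-- "There is a solution `u(x,t) = U(x,t)` to this equation" (p. 4) follows from the Theorem 2.3 witness,
since the feedback force vanishes along `U`. [cite: Jormakka2010, Theorem 2.4 (proof) p.4] -/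
theorem step24Solves_of_witness {ν c a : ℝ} (h : Theorem23Witness ν c a) : Step24Solves ν c a := by
  unfold Step24Solves
  rw [feedbackForce_self]
  exact h.1

/-- Theorem 2.3 (∃-form, as printed) follows from Lemma 2.1's data clause and the p. 4 witness: `f ≡ 0`,
`a > 0`, `(U, P)`; "becomes infinite" excludes every smooth continuation (`hasNoSmoothContinuation_of_tendsto`).
This is the paper's own inference on p. 4, kernel-checked. [cite: Jormakka2010, Theorem 2.3 pp.3–4] -/
theorem theorem23_of_witness {ν c a : ℝ} (ha : 0 < a) (hdata : IsPeriodicDatum initialField)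
    (h : Theorem23Witness ν c a) : Theorem23 ν := by
  obtain ⟨hsol, hinit, hper, hinf⟩ := h
  refine ⟨initialField, hdata, 0, isAdmissibleForce_zero, a, ha, blowupVelocity ν c a, blowupPressure ν c a,
    hsol, hinit, hper, ?_⟩
  rintro ⟨u', p', hu', -, -, hagree⟩
  exact hasNoSmoothContinuation_of_tendsto ha (hinf 0) hu' fun t ht => (hagree t ht).1

/-- **Composition of the proof of Theorem 2.4 (pp. 4–5), to the CLOSED-LOOP statement**: if `U` blows up as
`t → a⁻` (Theorem 2.3 witness) and every global smooth `u`-periodic closed-loop solution equals `U` on `[0,a)`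
(`Step24Unique`), then no such solution exists ("Since `u₁(x,t) = U₁(x,t)` becomes infinite when `t`
approaches `a`, the solution cannot be continued to the whole space", p. 5). The paper's logic composes THIS
far; it does not reach `NavierStokesBreakdownPeriodic` (module docstring). [claim: Jormakka2010, status: disputed] -/
theorem theorem24ClosedLoop_of_steps {ν c a : ℝ} (ha : 0 < a) (h23 : Theorem23Witness ν c a)
    (huniq : Step24Unique ν c a) : Theorem24ClosedLoop ν c a := by
  rintro ⟨u, p, hsol⟩
  have hagree := huniq u p hsol
  exact hasNoSmoothContinuation_of_tendsto ha (h23.2.2.2 0) hsol.1 hagree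

/-- The local (print-faithful) closed-loop uniqueness implies the global reading: a global smooth
`u`-periodic closed-loop solution restricts to a classical closed-loop solution on `[0, a)` (the fields of
`IsNavierStokesSolution` + smoothness ARE a classical solution on `[0,∞)`, tree bridge
`isNavierStokesSolution_and_smooth_iff`; then `IsClassicalNSSolutionOn.mono` to `Ico 0 a`).
[claim: Jormakka2010, status: disputed] -/
theorem step24Unique_of_local {ν c a : ℝ} (h : Step24UniqueLocal ν c a) : Step24Unique ν c a := by
  rintro u p ⟨hu, hp, hns, hper⟩
  have hcl : IsClassicalNSSolutionOn (Ici 0) ν (feedbackForce ν c a u) u p :=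
    ⟨hu, hp, fun t ht x => hns.momentum t ht x, fun t ht => hns.divFree t ht⟩
  exact h u p (hcl.mono Ico_subset_Ici_self (uniqueDiffOn_Ico 0 a)) hns.initial fun t ht => hper t ht.1

/-- The literal p. 5 sentence (`Step24ZeroForceUnique`) is implied by the load-bearing one (`Step24Unique`);
the converse — which the proof needs — is not derivable here. [claim: Jormakka2010, status: disputed] -/
theorem step24ZeroForceUnique_of_unique {ν c a : ℝ} (h : Step24Unique ν c a) : Step24ZeroForceUnique ν c a :=
  fun u p hsol _ => h u p hsol

/-- The closed-loop statement yields the weak as-printed reading of Theorem 2.4 (take `F = feedbackForce`;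
the extra admissibility conjunct only shrinks the excluded class). [claim: Jormakka2010, status: disputed] -/
theorem theorem24AsPrinted_of_closedLoop {ν c a : ℝ} (hdata : IsPeriodicDatum initialField)
    (h : Theorem24ClosedLoop ν c a) : Theorem24AsPrinted ν := by
  refine ⟨initialField, hdata, feedbackForce ν c a, ?_⟩
  rintro ⟨u, p, -, hsol⟩
  exact h ⟨u, p, hsol⟩

/-- **The weak as-printed reading is contentless**: it is a theorem of the kernel with no Navier–Stokes input
(datum `u⁰ = 0`; "feedback law" `F u := (t, x) ↦ x`, whose realized force is never `ℤ³`-periodic, so the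
excluded class is empty). Recorded so that no reader mistakes `Theorem24AsPrinted` for a form of Clay (D);
it is a (vacuous) proof OF the weak reading of the printed Theorem 2.4. [cite: Jormakka2010, Theorem 2.4 p.4] -/
theorem theorem24AsPrinted_trivial (ν : ℝ) : Theorem24AsPrinted ν := by
  refine ⟨fun _ => 0, ⟨contDiff_const, ?_, fun j x => rfl⟩, fun _ => fun _ x => x, ?_⟩
  · intro x
    simp [NSWave0.divergence]
  · rintro ⟨u, p, ⟨-, hper, -⟩, -⟩
    have h := congrArg (fun v : EuclideanSpace ℝ (Fin 3) => v 0) (hper 0 le_rfl 0 0)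
    simp at h

/-- **Clay (D) implies the strong as-printed reading** (constant feedback law `F := fun _ => f`). The converse,
which p. 13 would need ("Unless Theorem 2.4 is accepted as a proof of Statement D …"), is not derivable.
[cite: FeffermanClay2006, statement (D) p.2] -/
theorem theorem24AsPrintedStrong_of_clayD
    (hD : Summit.NavierStokesRegularity.NavierStokesRegularity.NavierStokesBreakdownPeriodic) {ν : ℝ}
    (hν : 0 < ν) :
    Theorem24AsPrintedStrong ν := by
  obtain ⟨u₀, f, hdat, hf, hno⟩ := clayD_iff.1 hD ν hν
  exact ⟨u₀, hdat, fun _ => f, fun _ => hf, hno⟩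

/-- The strong reading of the printed Theorem 2.4 implies the weak one. [cite: Jormakka2010, Theorem 2.4 p.4] -/
theorem theorem24AsPrinted_of_strong {ν : ℝ} (h : Theorem24AsPrintedStrong ν) : Theorem24AsPrinted ν := by
  obtain ⟨u₀, hdat, F, hF, hno⟩ := h
  exact ⟨u₀, hdat, F, fun ⟨u, p, _, hsol⟩ => hno ⟨u, p, hsol⟩⟩

/-- **IF Lemma 2.1 holds, Clay (D)'s conclusion fails at the exhibited data** (`u⁰`, realized force
`f ≡ 0`): the `g ≡ 0` member of (2.1) is a global smooth solution with `u(·,t)` periodic ("If `c = 0` then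
the solution is bounded and it is periodic as a function of `x`", p. 3). Conditional on `Lemma21 ν`; nothing
asserted. [cite: Jormakka2010, Theorem 2.2 (proof) p.3] -/
theorem not_clayDInstance_of_lemma21 {ν : ℝ} (h : Lemma21 ν) : ¬ ClayDInstance ν := by
  intro hD
  obtain ⟨hu, hp, hns⟩ := h.2 (fun _ => 0) contDiff_const rfl (deriv_const 0 0)
  exact hD ⟨velocity ν (fun _ => 0), pressure ν (fun _ => 0), hu, hp, hns,
    fun t _ => isLatticePeriodic_velocity ν _ t⟩

/-- The same in the CMI-errata reading: for `g ≡ 0` the pressure `e^{−2βt} P⁰(x)` is periodic too.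
[cite: Jormakka2010, Theorem 2.2 (proof) p.3] -/
theorem not_clayDErrataInstance_of_lemma21 {ν : ℝ} (h : Lemma21 ν) : ¬ ClayDErrataInstance ν := by
  intro hD
  obtain ⟨hu, hp, hns⟩ := h.2 (fun _ => 0) contDiff_const rfl (deriv_const 0 0)
  have hg'' : ∀ t : ℝ, deriv (deriv fun _ : ℝ => (0 : ℝ)) t = 0 := by
    intro t
    have : deriv (fun _ : ℝ => (0 : ℝ)) = fun _ => 0 := funext fun s => deriv_const s 0
    rw [this, deriv_const]
  exact hD ⟨velocity ν (fun _ => 0), pressure ν (fun _ => 0), ⟨hu, hp, hns,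
    fun t _ => isLatticePeriodic_velocity ν _ t⟩, fun t _ => isLatticePeriodic_pressure ν (hg'' t)⟩

/-- Printed-(D) instance ⇒ errata instance (fewer solutions to exclude), mirroring the tree's
`NavierStokesBreakdownPeriodic.pressurePeriodic`. [cite: FeffermanClay2006, statement (D) p.2 and errata page] -/
theorem clayDErrataInstance_of_clayDInstance {ν : ℝ} (h : ClayDInstance ν) : ClayDErrataInstance ν :=
  fun ⟨u, p, hsol, _⟩ => h ⟨u, p, hsol⟩

/-! ### The datum is of Clay class (8): smooth, divergence free, periodic (Lemma 2.1, proof, p. 2) -/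

/-- `u⁰` on the standard basis. [folklore] -/
private theorem initialField_eq :
    initialField = fun y : EuclideanSpace ℝ (Fin 3) =>
      (2 * π * (sin (2 * π * y 1) + cos (2 * π * y 2))) • EuclideanSpace.single (0 : Fin 3) (1 : ℝ) +
      (2 * π * (sin (2 * π * y 2) + cos (2 * π * y 0))) • EuclideanSpace.single (1 : Fin 3) (1 : ℝ) +
      (2 * π * (sin (2 * π * y 0) + cos (2 * π * y 1))) • EuclideanSpace.single (2 : Fin 3) (1 : ℝ) := by
  funext y
  ext i
  fin_cases i <;> simp [initialField]

/-- The coordinate functions are the projections. [folklore] -/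
private theorem hasFDerivAt_coord (j : Fin 3) (x : EuclideanSpace ℝ (Fin 3)) :
    HasFDerivAt (fun y : EuclideanSpace ℝ (Fin 3) => y j)
      (EuclideanSpace.proj j : EuclideanSpace ℝ (Fin 3) →L[ℝ] ℝ) x :=
  (EuclideanSpace.proj j : EuclideanSpace ℝ (Fin 3) →L[ℝ] ℝ).hasFDerivAt

/-- `tr L = ∑ₘ (L eₘ)ₘ` on `ℝ³` (as in the tree's `VorticityStretching.trace_eq_sum_coord`). [folklore] -/
private theorem trace_eq_sum_coord (L : EuclideanSpace ℝ (Fin 3) →L[ℝ] EuclideanSpace ℝ (Fin 3)) :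
    LinearMap.trace ℝ (EuclideanSpace ℝ (Fin 3)) (L : EuclideanSpace ℝ (Fin 3) →ₗ[ℝ] EuclideanSpace ℝ (Fin 3)) =
      ∑ m, L (EuclideanSpace.single m 1) m := by
  rw [LinearMap.trace_eq_sum_inner _ (EuclideanSpace.basisFun (Fin 3) ℝ)]
  simp [EuclideanSpace.basisFun_apply, EuclideanSpace.inner_single_left]

/-- "The initial vector field is smooth" (Lemma 2.1, proof, p. 2): `u⁰ ∈ C^∞`. [cite: Jormakka2010, Lemma 2.1 (proof) p.2] -/
theorem contDiff_initialField {n : WithTop ℕ∞} : ContDiff ℝ n initialField := by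
  have hc : ∀ j : Fin 3, ContDiff ℝ n (fun y : EuclideanSpace ℝ (Fin 3) => y j) := fun j =>
    (EuclideanSpace.proj j : EuclideanSpace ℝ (Fin 3) →L[ℝ] ℝ).contDiff
  rw [initialField_eq]
  exact (((contDiff_const.mul (((contDiff_const.mul (hc 1)).sin).add ((contDiff_const.mul (hc 2)).cos))).smul
      contDiff_const).add
    ((contDiff_const.mul (((contDiff_const.mul (hc 2)).sin).add ((contDiff_const.mul (hc 0)).cos))).smul
      contDiff_const)).add
    ((contDiff_const.mul (((contDiff_const.mul (hc 0)).sin).add ((contDiff_const.mul (hc 1)).cos))).smul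
      contDiff_const)

/-- "The initial vector field is … divergence-free" (Lemma 2.1, proof, p. 2): `div u⁰ = 0` (each
diagonal entry `∂ⱼu⁰ⱼ` of the Jacobian vanishes, `u⁰ⱼ` not depending on `xⱼ`). [cite: Jormakka2010, Lemma 2.1 (proof) p.2] -/
theorem isDivFree_initialField : NSWave0.IsDivFree initialField := by
  intro x
  have h0 := (((((hasFDerivAt_coord 1 x).const_mul (2 * π)).sin).add
    (((hasFDerivAt_coord 2 x).const_mul (2 * π)).cos)).const_mul (2 * π)).smul_const
    (EuclideanSpace.single (0 : Fin 3) (1 : ℝ))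
  have h1 := (((((hasFDerivAt_coord 2 x).const_mul (2 * π)).sin).add
    (((hasFDerivAt_coord 0 x).const_mul (2 * π)).cos)).const_mul (2 * π)).smul_const
    (EuclideanSpace.single (1 : Fin 3) (1 : ℝ))
  have h2 := (((((hasFDerivAt_coord 0 x).const_mul (2 * π)).sin).add
    (((hasFDerivAt_coord 1 x).const_mul (2 * π)).cos)).const_mul (2 * π)).smul_const
    (EuclideanSpace.single (2 : Fin 3) (1 : ℝ))
  have h : HasFDerivAt (fun y : EuclideanSpace ℝ (Fin 3) =>
      (2 * π * (sin (2 * π * y 1) + cos (2 * π * y 2))) • EuclideanSpace.single (0 : Fin 3) (1 : ℝ) +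
      (2 * π * (sin (2 * π * y 2) + cos (2 * π * y 0))) • EuclideanSpace.single (1 : Fin 3) (1 : ℝ) +
      (2 * π * (sin (2 * π * y 0) + cos (2 * π * y 1))) • EuclideanSpace.single (2 : Fin 3) (1 : ℝ)) _ x :=
    (h0.add h1).add h2
  rw [NSWave0.divergence, initialField_eq, h.fderiv, trace_eq_sum_coord, Fin.sum_univ_three]
  simp

/-- **The datum of Lemma 2.1 is of Clay class (8)**: smooth, divergence free, `ℤ³`-periodic ("The initial
vector field is smooth, periodic, bounded and divergence-free", p. 2) — the data clause of `Lemma21`,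
proved. [cite: Jormakka2010, Lemma 2.1 (proof) p.2] -/
theorem isPeriodicDatum_initialField : IsPeriodicDatum initialField :=
  ⟨contDiff_initialField, isDivFree_initialField, isLatticePeriodic_initialField⟩

/-! ### Cell schema: ordered step index, `ClaimedTheorem`, `claim_of_steps`, `ClayDelta`
(CARD-TEMPLATE §5, TYPING-HYGIENE §10–11)

ORDERED STEP INDEX (dependency order; `claim_of_steps` takes its hypotheses in this order):
* Step 1 = `Lemma21` (Lemma 2.1, p. 2; family (2.1); data clause kernel-proved: `isPeriodicDatum_initialField`)
* Step 2 = `Theorem23Witness` (proof of Theorem 2.3, p. 4: `U` solves on `[0,a)`, datum `u⁰`, periodic,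
  becomes infinite as `t → a⁻`; gives `Theorem23` by `theorem23_of_witness`)
* Step 3 = `Step24Solves` (proof of Theorem 2.4, p. 4: "There is a solution `u = U` to this equation";
  kernel from Step 2: `step24Solves_of_witness`)
* Step 4 = `Step24ZeroForceUnique` (p. 5 l. 19–22: "if the force is zero … then necessarily `u = U`";
  kernel from Step 5′: `step24ZeroForceUnique_of_unique`)
* Step 5 = `Step24UniqueLocal` (p. 5 l. 8–18, closed-loop uniqueness on `[0,a)`, the print-faithful LOCAL
  reading); Step 5′ = `Step24Unique` (GLOBAL reading; kernel from Step 5: `step24Unique_of_local`)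
* HEADLINE = `ClaimedTheorem` (= `Theorem24ClosedLoop` for all `ν > 0`, `c ≠ 0`, `a > 1`; kernel from Steps 2
  and 5: `claim_of_steps` / `theorem24ClosedLoop_of_steps`)
* LOGIC (not derivable, not asserted) = `ClaimedTheorem` ↛
  `Summit.NavierStokesRegularity.NavierStokesRegularity.NavierStokesBreakdownPeriodic` (§4 p. 13 l. 12–13);
  the exact missing hypothesis is `ClayDelta` (`clay_of_claimed_of_delta`, `clayD_of_claimed_of_delta`),
  refuted from Step 1 + HEADLINE (`not_clayDelta_of_lemma21`); at the exhibited data Clay (D)'s conclusion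
  fails given Step 1 (`not_clayDInstance_of_lemma21`, `not_clayDErrataInstance_of_lemma21`). -/

/-- **The claimed theorem (Theorem 2.4, p. 4) in the author's setting**, for every choice the proof admits
("v is a positive coefficient", p. 1; "`c ≠ 0`", p. 4; "`a` be larger than 1", p. 4): the CLOSED-LOOP
periodic Navier–Stokes problem with datum `u⁰` and feedback force `∂ₜu − ∂ₜU` has no global smooth
`u`-periodic solution. (The literal `∃ f`-over-feedback-laws renderings are `Theorem24AsPrinted` — provable
with no content, `theorem24AsPrinted_trivial` — and `Theorem24AsPrintedStrong`, which the paper's law does not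
witness; this closed-loop statement is what pp. 4–5 argue.) [claim: Jormakka2010, status: disputed] -/
def ClaimedTheorem : Prop :=
  ∀ ν : ℝ, 0 < ν → ∀ c a : ℝ, c ≠ 0 → 1 < a → Theorem24ClosedLoop ν c a

/-- **Composition** (the paper's logic, pp. 4–5, composes to `ClaimedTheorem`; hypotheses = Steps 1–5 in
the ORDERED STEP INDEX; Steps 1, 3, 4 are on the printed path but not consumed by the conclusion): Theorem
2.3's witness (`U` solves on `[0,a)` and becomes infinite as `t → a⁻`) and the LOCAL closed-loop uniqueness
(Step 5, via `step24Unique_of_local`) give the closed-loop non-existence for all admissible parameters. Pure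
logic over `theorem24ClosedLoop_of_steps`. [claim: Jormakka2010, status: disputed] -/
theorem claim_of_steps
    (_h1 : ∀ ν : ℝ, 0 < ν → Lemma21 ν)
    (h2 : ∀ ν : ℝ, 0 < ν → ∀ c a : ℝ, c ≠ 0 → 1 < a → Theorem23Witness ν c a)
    (_h3 : ∀ ν : ℝ, 0 < ν → ∀ c a : ℝ, c ≠ 0 → 1 < a → Step24Solves ν c a)
    (_h4 : ∀ ν : ℝ, 0 < ν → ∀ c a : ℝ, c ≠ 0 → 1 < a → Step24ZeroForceUnique ν c a)
    (h5 : ∀ ν : ℝ, 0 < ν → ∀ c a : ℝ, c ≠ 0 → 1 < a → Step24UniqueLocal ν c a) : ClaimedTheorem :=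
  fun ν hν c a hc ha =>
    theorem24ClosedLoop_of_steps (lt_trans one_pos ha) (h2 ν hν c a hc ha)
      (step24Unique_of_local (h5 ν hν c a hc ha))

/-- **`ClayDelta` — the exact bridging hypothesis from `ClaimedTheorem` to Clay (D)** (axis Δ3 FORCE of
`Literature.Claims.NS.ClayVariants`: Clay's `f` is a FUNCTION of `(x,t)` of class (8)–(9), "a given,
externally applied force (e.g. gravity)", Fefferman p. 1, fixed before "there exist no solutions (p,u)"; the
paper's `f` is the feedback functional `∂ₜu − ∂ₜU`, whose value along the intended solution is `0`, pp. 4–5,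
§4 p. 13: "a feedback control force is an external force to the controlled system"): for every `ν > 0` there
are admissible parameters `c ≠ 0`, `a > 1` such that every Clay-sense (smooth, `u`-periodic, global) solution
of the OPEN-loop problem `(ν, f ≡ 0, u⁰)` is a solution of the closed-loop problem. With it, `ClaimedTheorem`
gives printed Clay (D) with the paper's witnesses `(u⁰, f ≡ 0)` (`clay_of_claimed_of_delta`); it contradicts
Lemma 2.1 + Theorem 2.4 (`not_clayDelta_of_lemma21`). [claim: Jormakka2010, status: disputed] -/
def ClayDelta : Prop :=
  ∀ ν : ℝ, 0 < ν → ∃ c a : ℝ, c ≠ 0 ∧ 1 < a ∧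
    ∀ u p, IsGlobalPeriodicSolution ν 0 initialField u p →
      IsGlobalPeriodicSolution ν (feedbackForce ν c a u) initialField u p

/-- `ClayDelta → ClaimedTheorem → clayPeriodic.Breakdown` (printed Clay (D) in the cell's reference schema),
with the paper's witnesses: datum `u⁰` (of class (8): `isPeriodicDatum_initialField`) and force `f ≡ 0` (of
class (8)–(9): `ClayVariants.clayPeriodic_force_zero`). Without `ClayDelta` this implication is not derivable
(module docstring). [claim: Jormakka2010, status: disputed] -/
theorem clay_of_claimed_of_delta (hΔ : ClayDelta) (hC : ClaimedTheorem) : ClayVariants.clayPeriodic.Breakdown := by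
  intro ν hν
  obtain ⟨c, a, hc, ha, hbridge⟩ := hΔ ν hν
  refine ClayVariants.ClaySpec.BreakdownAt.of_not_solvable (S := ClayVariants.clayPeriodic)
    contDiff_initialField isDivFree_initialField isLatticePeriodic_initialField
    ClayVariants.isSmoothOnHalfSpace_zero ClayVariants.clayPeriodic_force_zero ?_
  rintro ⟨u, p, hu, hp, hns, hper⟩
  exact hC ν hν c a hc ha ⟨u, p, hbridge u p ⟨hu, hp, hns, hper⟩⟩

/-- The same, landing on the tree's printed-(D) leaf via `ClayVariants.clayPeriodic_breakdown_iff`.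
[claim: Jormakka2010, status: disputed] -/
theorem clayD_of_claimed_of_delta (hΔ : ClayDelta) (hC : ClaimedTheorem) :
    Summit.NavierStokesRegularity.NavierStokesRegularity.NavierStokesBreakdownPeriodic :=
  ClayVariants.clayPeriodic_breakdown_iff.mp (clay_of_claimed_of_delta hΔ hC)

/-- **The bridge contradicts the paper's own statements**: if Lemma 2.1 holds (its `g ≡ 0` member is a global
smooth `u`-periodic OPEN-loop solution for `(u⁰, f ≡ 0)`, p. 3) and Theorem 2.4 holds in the closed-loop
reading (`ClaimedTheorem`), then `ClayDelta` is false. [cite: Jormakka2010, Theorem 2.2 (proof) p.3] -/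
theorem not_clayDelta_of_lemma21 (hL : ∀ ν : ℝ, 0 < ν → Lemma21 ν) (hC : ClaimedTheorem) : ¬ ClayDelta := by
  intro hΔ
  obtain ⟨c, a, hc, ha, hbridge⟩ := hΔ 1 one_pos
  obtain ⟨hu, hp, hns⟩ := (hL 1 one_pos).2 (fun _ => 0) contDiff_const rfl (deriv_const 0 0)
  exact hC 1 one_pos c a hc ha ⟨velocity 1 (fun _ => 0), pressure 1 (fun _ => 0),
    hbridge _ _ ⟨hu, hp, hns, fun t _ => isLatticePeriodic_velocity 1 _ t⟩⟩

end Literature.Claims.NS.Jormakka2010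

end

-- WHAT THIS IS NOT: not a claim about NS regularity or blow-up; not a claim about any author beyond the
-- typed locator.
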